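import Mathlib
import Literature.Computability.AlgebraicComplexity.NewtonPolygonTauTransfer
import Literature.Computability.AlgebraicComplexity.RealTauConjectureProofs

/-!
# KPTT Thm 1 re-run on the LOG-FACTOR regime: `LogFactorBound → PER ∉ VP_ℂ` (crux-strategist sketch, stmt-5904)

`kpttTransferLog_holds`: the regime-R1 bound `m ≤ ⌊log₂ k⌋ ⇒ #vert ≤ (k t + 2)^b` (route item `LogFactorBound`,
stmt-ValiantsHypothesis-16048) already implies that the permanent family is not a `VP` family over `ℂ` — the same proof as
the tree's `KPTT.theorem1_holds` (NewtonPolygonTauTransfer.lean), with the sum-of-products form PADDED by zero products to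
`k' = k + 2^m` summands (so that `m ≤ log₂ k'`) before the bound is invoked.  This certifies the retarget recipe of
`Cruxes/NewtonTauWeak/STRATEGY-CENSUS.md` §Strengthen S-D: `closes` re-glues to `LogFactorBound` + this theorem.
Sorry-free.
-/

set_option linter.dupNamespace false

namespace Literature.Computability.AlgebraicComplexity

open scoped BigOperators
open MvPolynomial

namespace KPTT

open TavenasVn

/-- R1 of the regime split of `newtonTauWeak` (route item `LogFactorBound`, verbatim). -/
def logFactorBound : Prop :=
  ∃ b : ℕ, ∀ (k m t : ℕ) (f : Fin k → Fin m → MvPolynomial (Fin 2) ℂ), m ≤ Nat.log 2 k →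
    (∀ i j, (f i j).support.card ≤ t) →
      (Set.extremePoints ℝ (convexHull ℝ ((fun e : Fin 2 →₀ ℕ => fun i : Fin 2 => ((e i : ℕ) : ℝ)) ''
        ((∑ i, ∏ j, f i j).support : Set (Fin 2 →₀ ℕ))))).ncard ≤ (k * t + 2) ^ b

/-- ZERO PADDING: a sum of `k` products of `m ≥ 1` factors equals the sum of `k + p` products obtained by appending `p`
products all of whose factors are `0`. -/
theorem sum_prod_append_zero {k m p : ℕ} (hm : 0 < m) (f : Fin k → Fin m → MvPolynomial (Fin 2) ℂ) :
    (∑ i, ∏ j, Fin.append f (fun (_ : Fin p) (_ : Fin m) => (0 : MvPolynomial (Fin 2) ℂ)) i j) =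
      ∑ i, ∏ j, f i j := by
  have h1 : ∀ i : Fin k, (∏ j, Fin.append f (fun (_ : Fin p) (_ : Fin m) => (0 : MvPolynomial (Fin 2) ℂ))
      (Fin.castAdd p i) j) = ∏ j, f i j := fun i => by simp [Fin.append_left]
  have h2 : ∀ i : Fin p, (∏ j, Fin.append f (fun (_ : Fin p) (_ : Fin m) => (0 : MvPolynomial (Fin 2) ℂ))
      (Fin.natAdd k i) j) = 0 := fun i => by
    simp only [Fin.append_right]
    exact Finset.prod_eq_zero (Finset.mem_univ ⟨0, hm⟩) rfl
  rw [Fin.sum_univ_add, Finset.sum_congr rfl (fun i _ => h1 i), Finset.sum_congr rfl (fun i _ => h2 i),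
    Finset.sum_const_zero, add_zero]

/-- Under R1, every sum of `k` products of `m ≥ 1` `t`-sparse factors has `≤ ((k + 2^m) t + 2)^b` vertices (pad, then
`m ≤ log₂ (k + 2^m)`). -/
theorem vert_le_of_logFactorBound {b : ℕ}
    (hb : ∀ (k m t : ℕ) (f : Fin k → Fin m → MvPolynomial (Fin 2) ℂ), m ≤ Nat.log 2 k →
      (∀ i j, (f i j).support.card ≤ t) →
        (Set.extremePoints ℝ (convexHull ℝ ((fun e : Fin 2 →₀ ℕ => fun i : Fin 2 => ((e i : ℕ) : ℝ)) ''
          ((∑ i, ∏ j, f i j).support : Set (Fin 2 →₀ ℕ))))).ncard ≤ (k * t + 2) ^ b)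
    (k m t : ℕ) (hm : 0 < m) (f : Fin k → Fin m → MvPolynomial (Fin 2) ℂ) (hf : ∀ i j, (f i j).support.card ≤ t) :
    newtonVertexCount (∑ i, ∏ j, f i j) ≤ ((k + 2 ^ m) * t + 2) ^ b := by
  have hlog : m ≤ Nat.log 2 (k + 2 ^ m) :=
    calc m = Nat.log 2 (2 ^ m) := (Nat.log_pow one_lt_two m).symm
      _ ≤ Nat.log 2 (k + 2 ^ m) := Nat.log_mono_right (Nat.le_add_left _ _)
  have hf' : ∀ i j, (Fin.append f (fun (_ : Fin (2 ^ m)) (_ : Fin m) => (0 : MvPolynomial (Fin 2) ℂ)) i j).support.card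
      ≤ t := by
    intro i j
    refine Fin.addCases (fun i => ?_) (fun i => ?_) i
    · simpa [Fin.append_left] using hf i j
    · simp [Fin.append_right]
  have := hb (k + 2 ^ m) m t _ hlog hf'
  rwa [sum_prod_append_zero hm f] at this

/-- **`LogFactorBound → PER ∉ VP_ℂ`** — KPTT Thm 1 re-run in the log-factor regime. -/
theorem not_isVPFamily_per_of_logFactorBound (hR : logFactorBound) :
    ¬ IsVPFamily (fun n => perPoly (Fin n) ℂ) := by
  intro hVP
  obtain ⟨b, hb⟩ := hR
  obtain ⟨q, hq, hproj⟩ := exists_isProjection_hV_perPoly_complex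
  have hτ : IsPBounded fun n => complexity (perPoly (Fin n) ℂ) := hVP.2
  have hdP : IsPBounded (fun n => 2 * n + 3) :=
    (IsPBounded.iff_exists_le_mul_succ_pow _).2 ⟨3, 1, fun n => by rw [pow_one]; omega⟩
  obtain ⟨C₀, hC⟩ := exists_sps_xy_of_isProjection_perPoly hτ (fun n => 2 * n + 3) (fun n => 2 * n + 3) hdP
    (fun n => le_rfl) q hq (fun n => hV ℂ n) hproj (fun n => hV_multilinear n)
  obtain ⟨n, hn⟩ := exists_pow_sqrt_lt_two_pow ((2 * C₀ + 3) * b + 1)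
  obtain ⟨k, m, t, g, hk, hm, ht, hg, hsum⟩ := hC n
  have hpoly : (∑ i, ∏ j, g i j) = kpttPoly n := by rw [hsum]; exact aeval_xySubst_hV n
  set s : ℕ := Nat.sqrt (2 * n + 3) with hs
  set E : ℕ := C₀ * (s + 1) with hE
  have hB2 : 2 ≤ n + 2 := by omega
  have hn1 : 1 ≤ n := by
    rcases Nat.eq_zero_or_pos n with rfl | h
    · exact absurd hn (not_lt.2 (Nat.one_le_pow _ _ (by norm_num)))
    · exact h
  rcases Nat.eq_zero_or_pos m with rfl | hmpos
  · -- `m = 0`: the sum is the constant `k`, which has at most one vertex, but `F_n` has `2^n ≥ 2`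
    have hconst : (∑ i : Fin k, ∏ j : Fin 0, g i j) = C (k : ℂ) := by simp
    have hcount : newtonVertexCount (kpttPoly n) ≤ 1 := by
      rw [← hpoly, hconst]
      calc newtonVertexCount (C (k : ℂ) : MvPolynomial (Fin 2) ℂ)
          ≤ ((fun e : Fin 2 →₀ ℕ => fun i : Fin 2 => ((e i : ℕ) : ℝ)) ''
              ((C (k : ℂ) : MvPolynomial (Fin 2) ℂ).support : Set (Fin 2 →₀ ℕ))).ncard :=
            Set.ncard_le_ncard extremePoints_convexHull_subset (Set.toFinite _)
        _ ≤ ((C (k : ℂ) : MvPolynomial (Fin 2) ℂ).support : Set (Fin 2 →₀ ℕ)).ncard :=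
            Set.ncard_image_le (Finset.finite_toSet _)
        _ = (C (k : ℂ) : MvPolynomial (Fin 2) ℂ).support.card := Set.ncard_coe_finset _
        _ ≤ ({0} : Finset (Fin 2 →₀ ℕ)).card := by
            classical
            refine Finset.card_le_card ?_
            rw [MvPolynomial.support_C]
            split_ifs <;> simp
        _ = 1 := Finset.card_singleton _
    rw [newtonVertexCount_kpttPoly] at hcount
    have : 2 ≤ 2 ^ n := by
      calc 2 = 2 ^ 1 := by norm_num
        _ ≤ 2 ^ n := Nat.pow_le_pow_right (by norm_num) hn1
    omega
  · have hcount := vert_le_of_logFactorBound hb k m t hmpos g hg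
    rw [hpoly, newtonVertexCount_kpttPoly] at hcount
    -- `((k + 2^m) t + 2)^b ≤ (n+2)^{(2E+3) b}` and the exponent is `≤ ((2C+3) b + 1)(s+4)`
    have h1E : 1 ≤ (n + 2) ^ E := Nat.one_le_pow _ _ (by omega)
    have h2m : 2 ^ m ≤ (n + 2) ^ E :=
      calc 2 ^ m ≤ (n + 2) ^ m := Nat.pow_le_pow_left hB2 _
        _ ≤ (n + 2) ^ E := Nat.pow_le_pow_right (by omega) hm
    have hkt : (k + 2 ^ m) * t + 2 ≤ (n + 2) ^ (2 * E + 3) := by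
      have hk' : k + 2 ^ m ≤ 2 * (n + 2) ^ E := by omega
      have hkt' : (k + 2 ^ m) * t ≤ 2 * (n + 2) ^ (2 * E) :=
        calc (k + 2 ^ m) * t ≤ (2 * (n + 2) ^ E) * (n + 2) ^ E := Nat.mul_le_mul hk' ht
          _ = 2 * (n + 2) ^ (2 * E) := by rw [two_mul E, pow_add]; ring
      have h8 : 8 ≤ (n + 2) ^ 3 := by
        calc 8 = 2 ^ 3 := by norm_num
          _ ≤ (n + 2) ^ 3 := Nat.pow_le_pow_left hB2 3
      have h1' : 1 ≤ (n + 2) ^ (2 * E) := Nat.one_le_pow _ _ (by omega)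
      calc (k + 2 ^ m) * t + 2 ≤ (n + 2) ^ (2 * E) * 8 := by omega
        _ ≤ (n + 2) ^ (2 * E) * (n + 2) ^ 3 := Nat.mul_le_mul_left _ h8
        _ = (n + 2) ^ (2 * E + 3) := by rw [← pow_add]
    have hbound : ((k + 2 ^ m) * t + 2) ^ b ≤ (n + 2) ^ ((2 * E + 3) * b) :=
      calc ((k + 2 ^ m) * t + 2) ^ b ≤ ((n + 2) ^ (2 * E + 3)) ^ b := Nat.pow_le_pow_left hkt b
        _ = (n + 2) ^ ((2 * E + 3) * b) := by rw [← pow_mul]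
    have hexp : (2 * E + 3) * b ≤ ((2 * C₀ + 3) * b + 1) * (s + 4) := by
      rw [hE]; nlinarith
    have key : 2 ^ n ≤ (n + 2) ^ (((2 * C₀ + 3) * b + 1) * (s + 4)) :=
      calc 2 ^ n ≤ ((k + 2 ^ m) * t + 2) ^ b := hcount
        _ ≤ (n + 2) ^ ((2 * E + 3) * b) := hbound
        _ ≤ (n + 2) ^ (((2 * C₀ + 3) * b + 1) * (s + 4)) := Nat.pow_le_pow_right (by omega) hexp
    exact absurd key (not_le.2 hn)

/-- The retarget transfer item, discharged: `KpttTransferLog`. -/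
theorem kpttTransferLog_holds : logFactorBound → ¬ IsVPFamily (fun n => perPoly (Fin n) ℂ) :=
  not_isVPFamily_per_of_logFactorBound

end KPTT

end Literature.Computability.AlgebraicComplexity
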